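import Summits.HodgeConjecture.CorCM.Census.OcticTwistCoverSlices
import Summits.HodgeConjecture.CorCM.Census.QuarticTwistOrientation

/-!
# The octic twist `(ℤ/8 × B, (4,0))`, XVII: ORIENTED REDUCING FACES AND THE COVERING FAMILY WITH UPPER-END-ORIENTED SLICES (any parity)

COR-CM (cell `pub-hodgecm2`), count-neutral kernel combinatorics by the binder seat b09 (gen 34; lane COINVARIANT-TWIST / OCTIC RECON, the
even-order road map of `HOME/pub-hodgecm2-b09/lean-g34/OCTIC-LAW.md`), a sibling of parts X–XI (`Census/OcticTwistCoverShapes.lean`: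
`exists_rel'`; `Census/OcticTwistCoverSlices.lean`: `exists_cover_family'`, `res_of_tw_eq`, `plc_snd_ne`) using the quartic UPPER ENDS
(`QuarticTwistOrientation`: `IsMin`, `IsUpper`, **`exists_orientedSquare`**, `isMin_tw`, `isUpper_tw_iff`; `QuarticTwistCount`: `isRes_tw`,
`tw_flip'`) BY NAME.  One bookkeeping definition (`UCovers`) + theorems; no certificate, no named fact, no `sorry`.
HONEST FRAMING: `HC_CM` is NOT proved, here or anywhere in the tree; nothing here is a period or a headline.

WHY.  The octic law of parts XIII–XVI assumes `|B|` odd only through the quartic REGIME `reg` (unique minimiser of the Lee potentials), used by the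
exact affine reduction on the slices.  For `|B|` even adjacent regimes tie; gen 32ʼs quartic chain replaces the regime by upper ends.  §0
re-chooses the reducing face through every pair type of potential `≥ 2` (**`exists_orel`**) so that the coordinate-`0` / coordinate-`1` cross
squares are ORIENTED SQUARES: their three minor corners have smaller potential AND a common upper end `u`, equal to the upper end of the
centre unless the centre is balanced (the column faces at `2`-atoms and the mixed squares at `(±atom, ±atom)` types are as in part X).

WHAT.  `UCovers M` (§1): through every non-residual quartic type `s` the submodule `M ≤ ℤ^{Ty B}` contains a cross square `(s; p, q)` whose
three minor corners have smaller Lee potential and a COMMON UPPER END `u`, where `u` is the upper end of `s` unless `s` is balanced — the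
hypothesis under which the affine reduction runs WITHOUT a regime (part XX).  **`exists_ucover_family`** (§2, `|B| ≥ 3`, any parity):
a finite family `S` of octic faces, at most one per block of potential `≥ 2`, with `Covers₂ (spanMot S)`, whose SLICES
`{v | v ⊗ e_y ∈ spanMot S}` at every small residual `y` satisfy `UCovers`, and which contains every mixed square
`(e_{u+kδ_b} − e_u) ⊗ (e_{u′+k′δ_{b′}} − e_{u′})` (`k, k′ = ±1`).  The proof is part XIʼs transport argument with §0ʼs oriented squares:
upper ends and balancedness are carried by the quartic twists (`isUpper_tw_iff`, `isMin_tw`), and a type reached from its block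
representative by a swap-twist gets the representativeʼs coordinate-`1` square, swapped over.

## References
* [Pohlmann1968] H. Pohlmann, Algebraic cycles on abelian varieties of complex multiplication type, Ann. of Math. 88 (1968), Thm 1.
-/

namespace Summit.HodgeConjecture.CorCM.Census.OcticTwist

open Finset
open Summit.HodgeConjecture.CorCM.Census.QuarticTwist

variable (B : Type) [AddGroup B] [Fintype B] [DecidableEq B]

/-! ## §0 Oriented reducing faces -/

omit [AddGroup B] in
/-- **The reducing face through a type of potential `≥ 2`, ORIENTED** (`|B| ≥ 3`, any parity): an octic face relation through `T` with three
corners of smaller potential, which is (1) an ORIENTED cross square in coordinate `0` if `T.1` is non-residual (corners of smaller `Φ` with a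
common upper end `u`, `u` the upper end of `T.1` unless `T.1` is balanced), (3) an oriented cross square in coordinate `1` if `T.1` is a small
residual type and `T.2` is non-residual, (5) the mixed square `(e_a − e_u) ⊗ (e_{a′} − e_{u′})` at a `(±atom, ±atom)` type. [folklore] -/
theorem exists_orel (h3 : 3 ≤ Fintype.card B) (T : Ty₂ B) (hT : 2 ≤ pot B T) :
    ∃ T₁ T₂ T₃ : Ty₂ B,
      IsFace₂ B (Pi.single T 1 - Pi.single T₁ 1 - Pi.single T₂ 1 + Pi.single T₃ 1 : Ty₂ B → ℤ) ∧
      (pot B T₁ < pot B T ∧ pot B T₂ < pot B T ∧ pot B T₃ < pot B T) ∧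
      (¬ IsRes B T.1 → ∃ (u : ZMod 4) (p q : ZMod 2 × B), p.2 ≠ q.2 ∧
        (Pi.single T 1 - Pi.single T₁ 1 - Pi.single T₂ 1 + Pi.single T₃ 1 : Ty₂ B → ℤ) = tens B (faceVec B T.1 p q) (Pi.single T.2 1) ∧
        ((∀ w, IsMin B w T.1) ∨ IsUpper B u T.1) ∧
        (Phi B (QuarticTwist.flip B p T.1) < Phi B T.1 ∧ IsUpper B u (QuarticTwist.flip B p T.1)) ∧
        (Phi B (QuarticTwist.flip B q T.1) < Phi B T.1 ∧ IsUpper B u (QuarticTwist.flip B q T.1)) ∧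
        (Phi B (QuarticTwist.flip B q (QuarticTwist.flip B p T.1)) < Phi B T.1 ∧
          IsUpper B u (QuarticTwist.flip B q (QuarticTwist.flip B p T.1)))) ∧
      (IsRes B T.1 → (¬ ∃ (u : ZMod 4) (b : B), T.1 = atom B u b 2) → ¬ IsRes B T.2 → ∃ (u : ZMod 4) (p q : ZMod 2 × B), p.2 ≠ q.2 ∧
        (Pi.single T 1 - Pi.single T₁ 1 - Pi.single T₂ 1 + Pi.single T₃ 1 : Ty₂ B → ℤ) = tens B (Pi.single T.1 1) (faceVec B T.2 p q) ∧
        ((∀ w, IsMin B w T.2) ∨ IsUpper B u T.2) ∧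
        (Phi B (QuarticTwist.flip B p T.2) < Phi B T.2 ∧ IsUpper B u (QuarticTwist.flip B p T.2)) ∧
        (Phi B (QuarticTwist.flip B q T.2) < Phi B T.2 ∧ IsUpper B u (QuarticTwist.flip B q T.2)) ∧
        (Phi B (QuarticTwist.flip B q (QuarticTwist.flip B p T.2)) < Phi B T.2 ∧
          IsUpper B u (QuarticTwist.flip B q (QuarticTwist.flip B p T.2)))) ∧
      (∀ (u : ZMod 4) (b : B) (k : ZMod 4) (u' : ZMod 4) (b' : B) (k' : ZMod 4), T = (atom B u b k, atom B u' b' k') →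
        (k = 1 ∨ k = -1) → (k' = 1 ∨ k' = -1) →
        (Pi.single T 1 - Pi.single T₁ 1 - Pi.single T₂ 1 + Pi.single T₃ 1 : Ty₂ B → ℤ) =
          tens B (Pi.single (atom B u b k) 1 - Pi.single (cst B u) 1) (Pi.single (atom B u' b' k') 1 - Pi.single (cst B u') 1)) := by
  have pm1 : ∀ {k : ZMod 4}, (k = 1 ∨ k = -1) → k ≠ 0 ∧ k ≠ 2 := fun hk => by
    rcases hk with rfl | rfl <;> exact ⟨by decide, by decide⟩
  have hlee2 : lee 2 = 2 := rfl
  obtain ⟨s, t⟩ := T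
  simp only [pot_mk] at hT ⊢
  by_cases h1 : ¬ IsRes B s
  · -- (1) oriented cross square in coordinate 0
    obtain ⟨u, p, q, hpq, hor, ⟨hp, up⟩, ⟨hq, uq⟩, ⟨hpq', upq⟩⟩ := exists_orientedSquare B h3 h1
    refine ⟨(QuarticTwist.flip B p s, t), (QuarticTwist.flip B q s, t), (QuarticTwist.flip B q (QuarticTwist.flip B p s), t),
      Or.inl ⟨s, t, p, q, fun h => hpq (by rw [h]), (cface₀_eq B s t p q).symm⟩,
      ⟨by rw [pot_mk]; omega, by rw [pot_mk]; omega, by rw [pot_mk]; omega⟩,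
      fun _ => ⟨u, p, q, hpq, (cface₀_eq B s t p q).symm, hor, ⟨hp, up⟩, ⟨hq, uq⟩, ⟨hpq', upq⟩⟩, fun h => absurd h h1, ?_⟩
    intro u b k u' b' k' hT _ _
    exact absurd ⟨u, b, k, (Prod.ext_iff.mp hT).1⟩ h1
  rw [not_not] at h1
  by_cases h2 : ∃ (u : ZMod 4) (b : B), s = atom B u b 2
  · -- (2) column face in coordinate 0 at a 2-atom
    obtain ⟨u, b, rfl⟩ := h2
    refine ⟨(QuarticTwist.flip B (0, b) (atom B u b 2), t), (QuarticTwist.flip B (1, b) (atom B u b 2), t),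
      (QuarticTwist.flip B (1, b) (QuarticTwist.flip B (0, b) (atom B u b 2)), t),
      Or.inl ⟨atom B u b 2, t, (0, b), (1, b), fun h => zero_ne_one ((Prod.ext_iff.mp h).1 : (0 : ZMod 2) = 1),
        (cface₀_eq B _ t _ _).symm⟩, ⟨?_, ?_, ?_⟩, fun h => absurd ⟨u, b, 2, rfl⟩ h, fun _ h => absurd ⟨u, b, rfl⟩ h, ?_⟩
    · rw [pot_mk, Phi_atom B h3]; have := Phi_flip_two_atom_lt B h3 0 u b; rw [hlee2]; omega
    · rw [pot_mk, Phi_atom B h3]; have := Phi_flip_two_atom_lt B h3 1 u b; rw [hlee2]; omega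
    · rw [pot_mk, Phi_atom B h3, Phi_flip_flip_two_atom B h3]; rw [hlee2]; omega
    · intro u₁ b₁ k₁ u' b' k' hT hk _
      obtain ⟨-, -, h2k⟩ := (atom_eq_atom_iff B h3 (by decide : (2 : ZMod 4) ≠ 0)).mp (Prod.ext_iff.mp hT).1
      exact absurd h2k.symm (pm1 hk).2
  have hs1 : Phi B s ≤ 1 := Phi_le_one_of_isRes B h3 h1 h2
  by_cases h3' : ¬ IsRes B t
  · -- (3) oriented cross square in coordinate 1
    obtain ⟨u, p, q, hpq, hor, ⟨hp, up⟩, ⟨hq, uq⟩, ⟨hpq', upq⟩⟩ := exists_orientedSquare B h3 h3'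
    refine ⟨(s, QuarticTwist.flip B p t), (s, QuarticTwist.flip B q t), (s, QuarticTwist.flip B q (QuarticTwist.flip B p t)),
      Or.inr (Or.inl ⟨s, t, p, q, fun h => hpq (by rw [h]), (cface₁_eq B s t p q).symm⟩),
      ⟨by rw [pot_mk]; omega, by rw [pot_mk]; omega, by rw [pot_mk]; omega⟩,
      fun h => absurd h1 h, fun _ _ _ => ⟨u, p, q, hpq, (cface₁_eq B s t p q).symm, hor, ⟨hp, up⟩, ⟨hq, uq⟩, ⟨hpq', upq⟩⟩, ?_⟩
    intro u b k u' b' k' hT _ _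
    exact absurd ⟨u', b', k', (Prod.ext_iff.mp hT).2⟩ h3'
  rw [not_not] at h3'
  by_cases h4 : ∃ (u : ZMod 4) (b : B), t = atom B u b 2
  · -- (4) column face in coordinate 1 at a 2-atom
    obtain ⟨u, b, rfl⟩ := h4
    refine ⟨(s, QuarticTwist.flip B (0, b) (atom B u b 2)), (s, QuarticTwist.flip B (1, b) (atom B u b 2)),
      (s, QuarticTwist.flip B (1, b) (QuarticTwist.flip B (0, b) (atom B u b 2))),
      Or.inr (Or.inl ⟨s, atom B u b 2, (0, b), (1, b), fun h => zero_ne_one ((Prod.ext_iff.mp h).1 : (0 : ZMod 2) = 1),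
        (cface₁_eq B s _ _ _).symm⟩), ⟨?_, ?_, ?_⟩, fun h => absurd h1 h, fun _ _ h => absurd ⟨u, b, 2, rfl⟩ h, ?_⟩
    · rw [pot_mk, Phi_atom B h3 u b 2]; have := Phi_flip_two_atom_lt B h3 0 u b; rw [hlee2]; omega
    · rw [pot_mk, Phi_atom B h3 u b 2]; have := Phi_flip_two_atom_lt B h3 1 u b; rw [hlee2]; omega
    · rw [pot_mk, Phi_atom B h3 u b 2, Phi_flip_flip_two_atom B h3]; rw [hlee2]; omega
    · intro u₁ b₁ k₁ u' b' k' hT _ hk'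
      obtain ⟨-, -, h2k⟩ := (atom_eq_atom_iff B h3 (by decide : (2 : ZMod 4) ≠ 0)).mp (Prod.ext_iff.mp hT).2
      exact absurd h2k.symm (pm1 hk').2
  -- (5) the mixed square at a `(±atom, ±atom)` type
  have ht1 : Phi B t ≤ 1 := Phi_le_one_of_isRes B h3 h3' h4
  obtain ⟨u, b, k, hk, rfl⟩ := exists_atom_of_Phi_eq_one B h3 h1 (by omega)
  obtain ⟨u', b', k', hk', rfl⟩ := exists_atom_of_Phi_eq_one B h3 h3' (by omega)
  refine ⟨(cst B u, atom B u' b' k'), (atom B u b k, cst B u'), (cst B u, cst B u'), ?_, ⟨?_, ?_, ?_⟩, fun h => absurd h1 h,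
    fun _ _ h => absurd h3' h, ?_⟩
  · obtain ⟨j, hj⟩ := exists_flip_atom_eq_cst B u b hk
    obtain ⟨j', hj'⟩ := exists_flip_atom_eq_cst B u' b' hk'
    refine Or.inr (Or.inr ⟨atom B u b k, atom B u' b' k', (j, b), (j', b'), ?_⟩)
    rw [hj, hj', tens_sub_sub, single_eq_tens, single_eq_tens, single_eq_tens, single_eq_tens]
  · rw [pot_mk, Phi_cst B h3 u b]; omega
  · rw [pot_mk, Phi_cst B h3 u' b']; omega
  · rw [pot_mk, Phi_cst B h3 u b, Phi_cst B h3 u' b']; omega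
  · intro U V K U' V' K' hT _ _
    obtain ⟨hTs, hTt⟩ := Prod.ext_iff.mp hT
    obtain ⟨hu, hb, hkk⟩ := (atom_eq_atom_iff B h3 (pm1 hk).1).mp hTs
    obtain ⟨hu', hb', hkk'⟩ := (atom_eq_atom_iff B h3 (pm1 hk').1).mp hTt
    subst hu hb hkk hu' hb' hkk'
    rw [tens_sub_sub, single_eq_tens, single_eq_tens, single_eq_tens, single_eq_tens]

/-! ## §1 Upper-end-oriented covering -/

/-- **Upper-end-oriented covering.**  Through every non-residual type `s` the submodule `M` contains the class of a cross square `(s; p, q)`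
(`p`, `q` in different columns) whose three other corners have smaller Lee potential and a common upper end `u`, `u` being the upper end of
`s` unless `s` is balanced. [folklore] -/
def UCovers (M : Submodule ℤ (Ty B → ℤ)) : Prop :=
  ∀ s : Ty B, ¬ IsRes B s → ∃ (u : ZMod 4) (p q : ZMod 2 × B), p.2 ≠ q.2 ∧ faceVec B s p q ∈ M ∧
    ((∀ w, IsMin B w s) ∨ IsUpper B u s) ∧
    (Phi B (QuarticTwist.flip B p s) < Phi B s ∧ IsUpper B u (QuarticTwist.flip B p s)) ∧
    (Phi B (QuarticTwist.flip B q s) < Phi B s ∧ IsUpper B u (QuarticTwist.flip B q s)) ∧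
    (Phi B (QuarticTwist.flip B q (QuarticTwist.flip B p s)) < Phi B s ∧ IsUpper B u (QuarticTwist.flip B q (QuarticTwist.flip B p s)))

omit [AddGroup B] in
/-- Upper-end-oriented covering is inherited by larger submodules. [folklore] -/
theorem ucovers_mono {M M' : Submodule ℤ (Ty B → ℤ)} (h : M ≤ M') (hM : UCovers B M) : UCovers B M' := by
  intro s hs
  obtain ⟨u, p, q, hpq, hf, hor, h1, h2, h12⟩ := hM s hs
  exact ⟨u, p, q, hpq, h hf, hor, h1, h2, h12⟩

omit [DecidableEq B] in
/-- Balancedness is transported by twists. [folklore] -/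
theorem balanced_tw_iff (g : ZMod 4 × B) (s : Ty B) : (∀ w, IsMin B w (tw B g s)) ↔ ∀ w, IsMin B w s := by
  constructor
  · intro h w
    have := h (w + g.1)
    rwa [isMin_tw, add_sub_cancel_right] at this
  · intro h w
    rw [isMin_tw]
    exact h _

/-- **Transport of an oriented square by a twist**: orientation data at `r` give orientation data at `tw g r` with upper end `u + g.1` and
places `plc g p`, `plc g q`. [folklore] -/
theorem oriented_tw (g : ZMod 4 × B) {r : Ty B} {u : ZMod 4} {p q : ZMod 2 × B}
    (hor : (∀ w, IsMin B w r) ∨ IsUpper B u r)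
    (h1 : Phi B (QuarticTwist.flip B p r) < Phi B r ∧ IsUpper B u (QuarticTwist.flip B p r))
    (h2 : Phi B (QuarticTwist.flip B q r) < Phi B r ∧ IsUpper B u (QuarticTwist.flip B q r))
    (h12 : Phi B (QuarticTwist.flip B q (QuarticTwist.flip B p r)) < Phi B r ∧ IsUpper B u (QuarticTwist.flip B q (QuarticTwist.flip B p r))) :
    ((∀ w, IsMin B w (tw B g r)) ∨ IsUpper B (u + g.1) (tw B g r)) ∧
    (Phi B (QuarticTwist.flip B (plc B g p) (tw B g r)) < Phi B (tw B g r) ∧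
      IsUpper B (u + g.1) (QuarticTwist.flip B (plc B g p) (tw B g r))) ∧
    (Phi B (QuarticTwist.flip B (plc B g q) (tw B g r)) < Phi B (tw B g r) ∧
      IsUpper B (u + g.1) (QuarticTwist.flip B (plc B g q) (tw B g r))) ∧
    (Phi B (QuarticTwist.flip B (plc B g q) (QuarticTwist.flip B (plc B g p) (tw B g r))) < Phi B (tw B g r) ∧
      IsUpper B (u + g.1) (QuarticTwist.flip B (plc B g q) (QuarticTwist.flip B (plc B g p) (tw B g r)))) := by
  have hU : ∀ c : Ty B, IsUpper B u c → IsUpper B (u + g.1) (tw B g c) := fun c hc => by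
    rw [isUpper_tw_iff, add_sub_cancel_right]; exact hc
  refine ⟨?_, ⟨?_, ?_⟩, ⟨?_, ?_⟩, ⟨?_, ?_⟩⟩
  · rcases hor with hb | hu
    · exact Or.inl ((balanced_tw_iff B g r).mpr hb)
    · exact Or.inr (hU r hu)
  · rw [← tw_flip', Phi_tw, Phi_tw]; exact h1.1
  · rw [← tw_flip']; exact hU _ h1.2
  · rw [← tw_flip', Phi_tw, Phi_tw]; exact h2.1
  · rw [← tw_flip']; exact hU _ h2.2
  · rw [← tw_flip', ← tw_flip', Phi_tw, Phi_tw]; exact h12.1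
  · rw [← tw_flip', ← tw_flip']; exact hU _ h12.2

/-! ## §2 The covering family with upper-end-oriented slices -/

/-- **THE COVERING FAMILY WITH UPPER-END-ORIENTED SLICES** (`|B| ≥ 3`, any parity): a finite family `S` of octic faces, at most one per block
of potential `≥ 2`, whose motions cover (`Covers₂`), whose slice `{v | v ⊗ e_y ∈ spanMot S}` at every SMALL RESIDUAL passive coordinate `y`
satisfies `UCovers`, and which contains every mixed square at a `(±atom, ±atom)` type. [folklore] -/
theorem exists_ucover_family (h3 : 3 ≤ Fintype.card B) :
    ∃ S : Finset (Ty₂ B → ℤ), (∀ f ∈ S, IsFace₂ B f) ∧ S.card ≤ Fintype.card {ω : Orb₂ B // 2 ≤ potOrb B ω} ∧ Covers₂ B (spanMot B S) ∧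
      (∀ y : Ty B, IsRes B y → (¬ ∃ (u : ZMod 4) (b : B), y = atom B u b 2) → UCovers B ((spanMot B S).comap (emb₀ B y))) ∧
      (∀ (u : ZMod 4) (b : B) (k : ZMod 4) (u' : ZMod 4) (b' : B) (k' : ZMod 4), (k = 1 ∨ k = -1) → (k' = 1 ∨ k' = -1) →
        tens B (Pi.single (atom B u b k) 1 - Pi.single (cst B u) 1) (Pi.single (atom B u' b' k') 1 - Pi.single (cst B u') 1) ∈
          spanMot B S) := by
  classical
  haveI : Nonempty B := Fintype.card_pos_iff.mp (by omega)
  have hrep : ∀ ω : {ω : Orb₂ B // 2 ≤ potOrb B ω}, 2 ≤ pot B ω.1.out := by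
    intro ω
    have h := ω.2
    rw [← Quotient.out_eq ω.1, potOrb_mk] at h
    exact h
  choose T₁ T₂ T₃ hF hP hc1 hc3 hc5 using fun ω : {ω : Orb₂ B // 2 ≤ potOrb B ω} => exists_orel B h3 ω.1.out (hrep ω)
  let F : {ω : Orb₂ B // 2 ≤ potOrb B ω} → (Ty₂ B → ℤ) := fun ω =>
    Pi.single ω.1.out 1 - Pi.single (T₁ ω) 1 - Pi.single (T₂ ω) 1 + Pi.single (T₃ ω) 1
  let S := Finset.univ.image F
  have hmemS : ∀ ω, ∀ (e : Bool) (h : ZMod 4 × B), transl₂ B e h (F ω) ∈ spanMot B S :=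
    fun ω e h => transl₂_mem_spanMot_of_mem B (Finset.mem_image_of_mem F (Finset.mem_univ ω)) e h
  have hblock : ∀ T : Ty₂ B, 2 ≤ pot B T → ∃ (ω : {ω : Orb₂ B // 2 ≤ potOrb B ω}) (e : Bool) (h : ZMod 4 × B), act B e h ω.1.out = T := by
    intro T hT
    let ω : {ω : Orb₂ B // 2 ≤ potOrb B ω} := ⟨Quotient.mk (orbitRel₂ B) T, by rw [potOrb_mk]; exact hT⟩
    have hrel : (orbitRel₂ B).r ω.1.out T := Quotient.exact (Quotient.out_eq _)
    obtain ⟨e, h, hmove⟩ := hrel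
    exact ⟨ω, e, h, hmove⟩
  refine ⟨S, ?_, Finset.card_image_le.trans (by rw [Finset.card_univ]), ?_, fun s₀ hres h2a => ?_, ?_⟩
  · intro f hf
    obtain ⟨ω, _, rfl⟩ := Finset.mem_image.mp hf
    exact hF ω
  · intro T hT
    obtain ⟨ω, e, h, hmove⟩ := hblock T hT
    have hpot : pot B ω.1.out = pot B T := by rw [← hmove, pot_act]
    refine ⟨act B e h (T₁ ω), act B e h (T₂ ω), act B e h (T₃ ω), ?_, ?_, ?_, ?_⟩
    · have hmem := hmemS ω e h
      rw [transl₂_rel, hmove] at hmem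
      exact hmem
    · rw [pot_act, ← hpot]; exact (hP ω).1
    · rw [pot_act, ← hpot]; exact (hP ω).2.1
    · rw [pot_act, ← hpot]; exact (hP ω).2.2
  · -- UCovers for the slice `emb₀ s₀`
    intro s hs
    have hT : 2 ≤ pot B (s, s₀) := by rw [pot_mk]; have := two_le_Phi_of_not_isRes B h3 hs; omega
    obtain ⟨ω, e, h, hmove⟩ := hblock _ hT
    cases e
    · rw [act_false] at hmove
      have h1 : tw B h ω.1.out.1 = s := (Prod.ext_iff.mp hmove).1
      have h2 : tw B h ω.1.out.2 = s₀ := (Prod.ext_iff.mp hmove).2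
      have hs' : ¬ IsRes B ω.1.out.1 := fun hres' => hs (h1 ▸ isRes_tw B hres' h)
      obtain ⟨u, p, q, hpq, hrel, hor, hp, hq, hpq'⟩ := hc1 ω hs'
      have hot := oriented_tw B h hor hp hq hpq'
      refine ⟨u + h.1, plc B h p, plc B h q, plc_snd_ne B hpq, ?_, ?_, ?_, ?_, ?_⟩
      · show tens B (faceVec B s (plc B h p) (plc B h q)) (Pi.single s₀ 1) ∈ spanMot B S
        have hmem := hmemS ω false h
        dsimp only [F] at hmem
        rw [hrel, transl₂_false_cface₀, h1, h2] at hmem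
        exact hmem
      · rw [← h1]; exact hot.1
      · rw [← h1]; exact hot.2.1
      · rw [← h1]; exact hot.2.2.1
      · rw [← h1]; exact hot.2.2.2
    · rw [act_true] at hmove
      have h1 : tw B h (tw B (1, 0) ω.1.out.2) = s := (Prod.ext_iff.mp hmove).1
      have h2 : tw B h ω.1.out.1 = s₀ := (Prod.ext_iff.mp hmove).2
      obtain ⟨hres1, hn2⟩ := res_of_tw_eq B hres h2a h h2
      rw [tw_tw] at h1
      have ht' : ¬ IsRes B ω.1.out.2 := fun hres' => hs (h1 ▸ isRes_tw B hres' _)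
      obtain ⟨u, p, q, hpq, hrel, hor, hp, hq, hpq'⟩ := hc3 ω hres1 hn2 ht'
      have hot := oriented_tw B (h + (1, 0)) hor hp hq hpq'
      refine ⟨u + (h + (1, 0)).1, plc B (h + (1, 0)) p, plc B (h + (1, 0)) q, plc_snd_ne B hpq, ?_, ?_, ?_, ?_, ?_⟩
      · show tens B (faceVec B s (plc B (h + (1, 0)) p) (plc B (h + (1, 0)) q)) (Pi.single s₀ 1) ∈ spanMot B S
        have hmem := hmemS ω true h
        dsimp only [F] at hmem
        rw [hrel, transl₂_true_tens, transl_single, transl_faceVec, h1, h2] at hmem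
        exact hmem
      · rw [← h1]; exact hot.1
      · rw [← h1]; exact hot.2.1
      · rw [← h1]; exact hot.2.2.1
      · rw [← h1]; exact hot.2.2.2
  · -- the mixed squares at the `(±atom, ±atom)` types
    intro u b k u' b' k' hk hk'
    have hT : 2 ≤ pot B (atom B u b k, atom B u' b' k') := by
      rw [pot_mk, Phi_atom B h3, Phi_atom B h3, (lee_eq_one_iff k).mpr hk, (lee_eq_one_iff k').mpr hk']
    obtain ⟨ω, e, h, hmove⟩ := hblock _ hT
    cases e
    · rw [act_false] at hmove
      have h1 : tw B h ω.1.out.1 = atom B u b k := (Prod.ext_iff.mp hmove).1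
      have h2 : tw B h ω.1.out.2 = atom B u' b' k' := (Prod.ext_iff.mp hmove).2
      have ha : ω.1.out.1 = atom B (u - h.1) (b + h.2) k := by
        have := congrArg (tw B (-h)) h1
        rw [tw_neg_tw, tw_atom] at this
        rw [this, Prod.fst_neg, Prod.snd_neg, sub_neg_eq_add, ← sub_eq_add_neg]
      have ha' : ω.1.out.2 = atom B (u' - h.1) (b' + h.2) k' := by
        have := congrArg (tw B (-h)) h2
        rw [tw_neg_tw, tw_atom] at this
        rw [this, Prod.fst_neg, Prod.snd_neg, sub_neg_eq_add, ← sub_eq_add_neg]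
      have hrel := hc5 ω _ _ _ _ _ _ (Prod.ext ha ha') hk hk'
      have hmem := hmemS ω false h
      dsimp only [F] at hmem
      rw [hrel, transl₂_false_tens, transl_sub, transl_sub, transl_single, transl_single, transl_single, transl_single, tw_atom, tw_atom,
        tw_cst, tw_cst, sub_add_cancel, sub_add_cancel, add_sub_cancel_right, add_sub_cancel_right] at hmem
      exact hmem
    · rw [act_true] at hmove
      have h1 : tw B h (tw B (1, 0) ω.1.out.2) = atom B u b k := (Prod.ext_iff.mp hmove).1
      have h2 : tw B h ω.1.out.1 = atom B u' b' k' := (Prod.ext_iff.mp hmove).2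
      rw [tw_tw] at h1
      have ha : ω.1.out.1 = atom B (u' - h.1) (b' + h.2) k' := by
        have := congrArg (tw B (-h)) h2
        rw [tw_neg_tw, tw_atom] at this
        rw [this, Prod.fst_neg, Prod.snd_neg, sub_neg_eq_add, ← sub_eq_add_neg]
      have ha' : ω.1.out.2 = atom B (u - (h + (1, 0)).1) (b + (h + (1, 0)).2) k := by
        have := congrArg (tw B (-(h + (1, 0)))) h1
        rw [tw_neg_tw, tw_atom] at this
        rw [this, Prod.fst_neg, Prod.snd_neg, sub_neg_eq_add, ← sub_eq_add_neg]
      have hrel := hc5 ω _ _ _ _ _ _ (Prod.ext ha ha') hk' hk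
      have hmem := hmemS ω true h
      dsimp only [F] at hmem
      rw [hrel, transl₂_true_tens, transl_sub, transl_sub, transl_single, transl_single, transl_single, transl_single, tw_atom, tw_atom,
        tw_cst, tw_cst, sub_add_cancel, sub_add_cancel, add_sub_cancel_right, add_sub_cancel_right] at hmem
      exact hmem

end Summit.HodgeConjecture.CorCM.Census.OcticTwist
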